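import Summits.QuantumFields.YangMills.Theorems.BalabanUVNodesN19TiltPathGaussianTwoRuns

/-!
# BalabanUVNodes ∕ node N19 (NE7 bracket) — THE ANNEALED (TILT-PATH) ROAD ON A GENERIC FINITE INDEX `ι`: Gaussian integrability, Feynman–Hellmann along affine paths of
# coercive quadratic actions on `ι → ℝ`, and EQUIPARTITION `∫ (φ·Δφ)e^{−½φ·Δφ}dφ = |ι|·∫ e^{−½φ·Δφ}dφ` (the calculus behind the RELATIVE two-run bound of module 22a-II)

Cell `pub-ymgap`, HUMAN RULING D-0062 (Track A), R134 ACCELERATION seat `pub-ymgap-dag-n19-c` (N19 NE7, strategy s1), generation 14, module 22a-I; route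
`Summits/QuantumFields/YangMills/Theses/BalabanUVNodes.lean` rev 21 (K3⁵ `SpineGivenEndpointR13SepCoP` = stmt-QuantumFields-20296, `--supports … --as helper`); venue R424
(namespace `Summit.QuantumFields.YangMills.BalabanUVNodes.N19AnnealedGeneric`).  ADDITIVE — imports this seat's `…N19TiltPathGaussianTwoRuns` (p516244: the L¹ re-tilt
`abs_ratio_sub_ratio_le` on ANY measure space; through it `…N19TiltPathGaussian` p515255 — `mul_exp_neg_le`, `exp_mul_mem` — and n14-c's King-model files and Mathlib) — all CITED,
nothing re-proved at the same type; THEOREMS ONLY (0 `def`), modifies nothing.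

WHY (bus INTENT-22, door d17 LOCALITY).  Every King-storey NE7 remainder in the tree scales with the VOLUME |Tor M| (n14-c's `cauchy_genFun_kingTwoClass`; this seat's
`matchingModConstants_kingFullSpace`, p518223): the annealed two-run bound `abs_log_sub_log_sub_le_of_actionBound` (p516244 §5) pays `ϑ·E|φ|² ≤ ϑ·|Tor M|∕(2γ)` for the action
difference.  For a LOCAL observable (depending on the field through the sites of `X ⊆ Tor M` only) the Gaussian integral MARGINALISES to the `|X|`-dimensional field space
`X → ℝ` with the Schur-complement action (module 22b), and the two marginal actions inherit from the full ones not a `|ψ|²`-majorant but a RELATIVE (form) sandwich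
`S_B ≤ (1+ε)S_A`, `S_A ≤ (1+ε)S_B`.  This module therefore re-issues the Gaussian calculus of p515255 on a GENERIC finite index type `ι` («GENERAL-N WHERE FREE»: the
`Tor M` statements of p515255 §2∕§3 are the `ι = Tor M` instances — they are NOT re-filed and stay the cited editions at King's letters); module 22a-II
(`…N19AnnealedRelative`) proves on it the RELATIVE-CLOSENESS two-run bound with remainder `(e^{2|t|B} − 1)·ε·|ι|∕2` by EQUIPARTITION `E_u[φ·Δ_uφ] = |ι|` — no coercivity
constant, no operator norm, no volume but the dimension of the space the actions live on; module 22b marginalises; module 22c puts the three together at King's letters: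
`δ_K ∝ |X|`, not `|Tor M|`.
* §1 [folklore] `sq_le_dotProduct_self`, `measurable_quadForm`, `dotProduct_mulVec_smul`, `dotProduct_add_smul_mulVec`, `dotProduct_sub_mulVec`,
  `abs_quadForm_le` (crude `|φ·Dφ| ≤ (Σ|D_xy|)φ·φ`), `coercive_chord`, `coercive_smul_one`, `exp_neg_quadForm_le_prod`, `integrable_exp_neg_quadForm`,
  `integrable_exp_neg_mul_dotProduct`, `integrable_dressed`, `dressedZ_pos`.
* §2 [folklore] `abs_pathDeriv_integrand_le`, `integrable_pathDeriv_integrand`, ★ `hasDerivAt_integral_exp_neg_path` (Feynman–Hellmann along an affine path),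
  `continuousOn_integral_exp_neg_path`.
* §3 [folklore] ★ `integral_quadForm_mul_exp_neg` — EQUIPARTITION on `ι → ℝ`: `∫ (φ·Δφ)e^{−½φ·Δφ}dφ = |ι|·∫ e^{−½φ·Δφ}dφ`.

HONEST FRAMING.  Finite-dimensional Gaussian calculus [folklore]; consumer = King's `A = 0` scalar MODEL (module 22c) — NOT Bałaban's NE7 (NOT PRINTED as a two-run statement for
d = 4; NODE O's objects).  Count-neutral; N18 ∕ N19 ∕ N20 NOT discharged; counts UNMOVED (5∕27).  Everything PROVED (0 `sorry`, 0 named facts, standard axioms).  One finite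
four-torus programme at fixed ε; NOT ℝ⁴, NOT OS, NOT a mass gap, NOT Clay.
-/

noncomputable section

namespace Summit.QuantumFields.YangMills.BalabanUVNodes.N19AnnealedGeneric

open MeasureTheory Set Filter Real Matrix Topology
open scoped BigOperators
open Literature.MathematicalPhysics.QuantumFieldTheory.Balaban1983to89.QGQInverse (Coercive)
open Literature.LinearAlgebra.Matrix (dotProduct_self_nonneg_real)
open Summit.QuantumFields.YangMills.BalabanUVNodes.N19TiltPathGaussian (mul_exp_neg_le exp_mul_mem)
open Summit.QuantumFields.YangMills.BalabanUVNodes.N19TiltPathGaussianTwoRuns (abs_ratio_sub_ratio_le)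

variable {ι : Type*} [Fintype ι] [DecidableEq ι]

/-! ## §1 Quadratic-form algebra and Gaussian integrability on the field space `ι → ℝ` of a generic finite index -/
section Algebra

omit [DecidableEq ι] in
/-- One coordinate square is below the Euclidean square norm. [folklore] -/
theorem sq_le_dotProduct_self (φ : ι → ℝ) (x : ι) : φ x ^ 2 ≤ φ ⬝ᵥ φ := by
  rw [show φ ⬝ᵥ φ = ∑ y, φ y ^ 2 by simp [dotProduct, sq]]
  exact Finset.single_le_sum (fun y _ => sq_nonneg (φ y)) (Finset.mem_univ x)

omit [DecidableEq ι] in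
/-- A quadratic form `φ ↦ φ·Δφ` is measurable (a polynomial in the coordinates). [folklore] -/
theorem measurable_quadForm (Δ : Matrix ι ι ℝ) : Measurable fun φ : ι → ℝ => φ ⬝ᵥ (Δ *ᵥ φ) := by
  have h : (fun φ : ι → ℝ => φ ⬝ᵥ (Δ *ᵥ φ)) = fun φ => ∑ i, φ i * ∑ j, Δ i j * φ j := by
    ext φ
    simp [dotProduct, Matrix.mulVec]
  rw [h]
  fun_prop

omit [DecidableEq ι] in
/-- Scaling: `(cφ)·Δ(cφ) = c²·φ·Δφ`. [folklore] -/
theorem dotProduct_mulVec_smul (Δ : Matrix ι ι ℝ) (c : ℝ) (φ : ι → ℝ) : (c • φ) ⬝ᵥ (Δ *ᵥ (c • φ)) = c ^ 2 * (φ ⬝ᵥ (Δ *ᵥ φ)) := by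
  rw [Matrix.mulVec_smul, smul_dotProduct, dotProduct_smul, smul_eq_mul, smul_eq_mul]
  ring

omit [DecidableEq ι] in
/-- The affine path of forms: `φ·(Δ + uD)φ = φ·Δφ + u·φ·Dφ`. [folklore] -/
theorem dotProduct_add_smul_mulVec (Δ D : Matrix ι ι ℝ) (u : ℝ) (φ : ι → ℝ) :
    φ ⬝ᵥ ((Δ + u • D) *ᵥ φ) = φ ⬝ᵥ (Δ *ᵥ φ) + u * (φ ⬝ᵥ (D *ᵥ φ)) := by
  rw [Matrix.add_mulVec, dotProduct_add, Matrix.smul_mulVec, dotProduct_smul, smul_eq_mul]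

omit [DecidableEq ι] in
/-- The ray: `φ·(uΔ)φ = u·φ·Δφ`. [folklore] -/
theorem dotProduct_smul_mulVec (Δ : Matrix ι ι ℝ) (u : ℝ) (φ : ι → ℝ) : φ ⬝ᵥ ((u • Δ) *ᵥ φ) = u * (φ ⬝ᵥ (Δ *ᵥ φ)) := by
  rw [Matrix.smul_mulVec, dotProduct_smul, smul_eq_mul]

omit [DecidableEq ι] in
/-- `φ·(Δ_B − Δ_A)φ = φ·Δ_Bφ − φ·Δ_Aφ`. [folklore] -/
theorem dotProduct_sub_mulVec (ΔA ΔB : Matrix ι ι ℝ) (φ : ι → ℝ) :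
    φ ⬝ᵥ ((ΔB - ΔA) *ᵥ φ) = φ ⬝ᵥ (ΔB *ᵥ φ) - φ ⬝ᵥ (ΔA *ᵥ φ) := by
  rw [Matrix.sub_mulVec, dotProduct_sub]

omit [DecidableEq ι] in
/-- A crude, hypothesis-free form bound: `|φ·Dφ| ≤ (Σ_{x,y}|D_{xy}|)·(φ·φ)`. [folklore] -/
theorem abs_quadForm_le (D : Matrix ι ι ℝ) (φ : ι → ℝ) : |φ ⬝ᵥ (D *ᵥ φ)| ≤ (∑ x, ∑ y, |D x y|) * (φ ⬝ᵥ φ) := by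
  have h2 : ∀ x y : ι, |φ x| * |φ y| ≤ φ ⬝ᵥ φ := fun x y => by
    have hxy := two_mul_le_add_sq (|φ x|) (|φ y|)
    rw [sq_abs, sq_abs] at hxy
    have hx := sq_le_dotProduct_self φ x
    have hy := sq_le_dotProduct_self φ y
    nlinarith
  calc |φ ⬝ᵥ (D *ᵥ φ)| = |∑ x, φ x * ∑ y, D x y * φ y| := by simp [dotProduct, Matrix.mulVec]
    _ ≤ ∑ x, |φ x * ∑ y, D x y * φ y| := Finset.abs_sum_le_sum_abs _ _
    _ ≤ ∑ x, ∑ y, |D x y| * (φ ⬝ᵥ φ) := by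
        refine Finset.sum_le_sum fun x _ => ?_
        rw [abs_mul]
        calc |φ x| * |∑ y, D x y * φ y| ≤ |φ x| * ∑ y, |D x y * φ y| :=
              mul_le_mul_of_nonneg_left (Finset.abs_sum_le_sum_abs _ _) (abs_nonneg _)
          _ = ∑ y, |D x y| * (|φ x| * |φ y|) := by
              rw [Finset.mul_sum]
              refine Finset.sum_congr rfl fun y _ => ?_
              rw [abs_mul]
              ring
          _ ≤ ∑ y, |D x y| * (φ ⬝ᵥ φ) := Finset.sum_le_sum fun y _ => mul_le_mul_of_nonneg_left (h2 x y) (abs_nonneg _)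
    _ = (∑ x, ∑ y, |D x y|) * (φ ⬝ᵥ φ) := by rw [Finset.sum_mul]; refine Finset.sum_congr rfl fun x _ => by rw [Finset.sum_mul]

omit [DecidableEq ι] in
/-- Coercivity is preserved along the chord between two `γ`-coercive forms (convexity). [folklore] -/
theorem coercive_chord {ΔA ΔB : Matrix ι ι ℝ} {γ : ℝ} (hA : Coercive ΔA γ) (hB : Coercive ΔB γ) {u : ℝ} (hu0 : 0 ≤ u) (hu1 : u ≤ 1) :
    Coercive (ΔA + u • (ΔB - ΔA)) γ := fun φ => by
  rw [dotProduct_add_smul_mulVec, dotProduct_sub_mulVec]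
  have h1 := hA φ
  have h2 := hB φ
  nlinarith

/-- The isotropic form `c·1` is `c`-coercive. [folklore] -/
theorem coercive_smul_one (c : ℝ) : Coercive (c • (1 : Matrix ι ι ℝ)) c := fun φ => by
  rw [Matrix.smul_mulVec, Matrix.one_mulVec, dotProduct_smul, smul_eq_mul]

omit [DecidableEq ι] in
/-- Pointwise Gaussian domination of a coercive Boltzmann factor by a product of one-dimensional Gaussians. [folklore] -/
theorem exp_neg_quadForm_le_prod {Δ : Matrix ι ι ℝ} {γ : ℝ} (hc : Coercive Δ γ) (φ : ι → ℝ) :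
    Real.exp (-(φ ⬝ᵥ (Δ *ᵥ φ) / 2)) ≤ ∏ x, Real.exp (-(γ / 2) * φ x ^ 2) := by
  rw [← Real.exp_sum, ← Finset.mul_sum]
  refine Real.exp_le_exp.2 ?_
  have h := hc φ
  rw [show φ ⬝ᵥ φ = ∑ y, φ y ^ 2 by simp [dotProduct, sq]] at h
  linarith

omit [DecidableEq ι] in
/-- **THE BOLTZMANN FACTOR OF A COERCIVE QUADRATIC ACTION IS LEBESGUE-INTEGRABLE** on `ι → ℝ` [folklore; Mathlib `Integrable.fintype_prod` ∘ `integrable_exp_neg_mul_sq`]. -/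
theorem integrable_exp_neg_quadForm {Δ : Matrix ι ι ℝ} {γ : ℝ} (hγ : 0 < γ) (hc : Coercive Δ γ) :
    Integrable (fun φ : ι → ℝ => Real.exp (-(φ ⬝ᵥ (Δ *ᵥ φ) / 2))) := by
  have hprod : Integrable (fun φ : ι → ℝ => ∏ x, Real.exp (-(γ / 2) * φ x ^ 2)) := by
    rw [MeasureTheory.volume_pi]
    exact Integrable.fintype_prod (f := fun (_ : ι) (y : ℝ) => Real.exp (-(γ / 2) * y ^ 2)) fun _ => integrable_exp_neg_mul_sq (by linarith)
  refine hprod.mono' (Real.measurable_exp.comp ((measurable_quadForm Δ).div_const 2).neg).aestronglyMeasurable (Eventually.of_forall fun φ => ?_)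
  rw [Real.norm_eq_abs, abs_of_pos (Real.exp_pos _)]
  exact exp_neg_quadForm_le_prod hc φ

/-- The isotropic Gaussian `e^{−c(φ·φ)∕2}` (`c > 0`) is integrable. [folklore] -/
theorem integrable_exp_neg_mul_dotProduct {c : ℝ} (hc : 0 < c) : Integrable (fun φ : ι → ℝ => Real.exp (-(c * (φ ⬝ᵥ φ) / 2))) := by
  have h := integrable_exp_neg_quadForm hc (coercive_smul_one (ι := ι) c)
  refine h.congr (Eventually.of_forall fun φ => ?_)
  simp only [Matrix.smul_mulVec, Matrix.one_mulVec, dotProduct_smul, smul_eq_mul]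

omit [DecidableEq ι] in
/-- … and so is the DRESSED factor `e^{−φ·Δφ∕2}·e^{tW(φ)}` for a bounded measurable observable. [folklore] -/
theorem integrable_dressed {Δ : Matrix ι ι ℝ} {γ : ℝ} (hγ : 0 < γ) (hc : Coercive Δ γ) {W : (ι → ℝ) → ℝ} {B : ℝ} (hWm : Measurable W)
    (hWb : ∀ φ, |W φ| ≤ B) (t : ℝ) :
    Integrable (fun φ : ι → ℝ => Real.exp (-(φ ⬝ᵥ (Δ *ᵥ φ) / 2)) * Real.exp (t * W φ)) := by
  have hgm : Measurable fun φ : ι → ℝ => Real.exp (t * W φ) := Real.measurable_exp.comp (hWm.const_mul t)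
  refine (integrable_exp_neg_quadForm hγ hc).mul_bdd (c := Real.exp (|t| * B)) hgm.aestronglyMeasurable (Eventually.of_forall fun φ => ?_)
  rw [Real.norm_eq_abs, Real.abs_exp]
  exact (exp_mul_mem hWb t φ).2

omit [DecidableEq ι] in
/-- The dressed Gaussian partition function on the whole of `ι → ℝ` is positive. [folklore] -/
theorem dressedZ_pos {Δ : Matrix ι ι ℝ} {γ : ℝ} (hγ : 0 < γ) (hc : Coercive Δ γ) {W : (ι → ℝ) → ℝ} {B : ℝ} (hWm : Measurable W)
    (hWb : ∀ φ, |W φ| ≤ B) (t : ℝ) : 0 < ∫ φ : ι → ℝ, Real.exp (-(φ ⬝ᵥ (Δ *ᵥ φ) / 2)) * Real.exp (t * W φ) := by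
  have h := integrable_dressed hγ hc hWm hWb t
  have heq : (fun φ : ι → ℝ => Real.exp (-(φ ⬝ᵥ (Δ *ᵥ φ) / 2)) * Real.exp (t * W φ)) = fun φ => Real.exp (-(φ ⬝ᵥ (Δ *ᵥ φ) / 2) + t * W φ) := by
    funext φ
    rw [Real.exp_add]
  rw [heq] at h ⊢
  exact integral_exp_pos h

end Algebra

/-! ## §2 Feynman–Hellmann along an affine path of coercive quadratic actions on `ι → ℝ` -/
section FeynmanHellmann

omit [DecidableEq ι] in
/-- **THE GAUSSIAN MAJORANT OF THE PATH DERIVATIVE** [folklore]: `Δ` `γ`-coercive (`γ > 0`), `|φ·Dφ| ≤ κ·(φ·φ)` (`κ ≥ 0`), `|g| ≤ G` ⇒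
`|−½(φ·Dφ)·e^{−½φ·Δφ}·g(φ)| ≤ (2κG∕γ)·e^{−(γ∕2)(φ·φ)∕2}`. -/
theorem abs_pathDeriv_integrand_le {Δ D : Matrix ι ι ℝ} {γ κ G : ℝ} (hγ : 0 < γ) (hκ : 0 ≤ κ) (hc : Coercive Δ γ)
    (hD : ∀ φ : ι → ℝ, |φ ⬝ᵥ (D *ᵥ φ)| ≤ κ * (φ ⬝ᵥ φ)) {g : (ι → ℝ) → ℝ} (hgb : ∀ φ, |g φ| ≤ G) (φ : ι → ℝ) :
    |-(φ ⬝ᵥ (D *ᵥ φ) / 2) * Real.exp (-(φ ⬝ᵥ (Δ *ᵥ φ) / 2)) * g φ| ≤ 2 * κ * G / γ * Real.exp (-(γ / 2 * (φ ⬝ᵥ φ) / 2)) := by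
  have hG : 0 ≤ G := (abs_nonneg _).trans (hgb φ)
  have hφ : 0 ≤ φ ⬝ᵥ φ := dotProduct_self_nonneg_real φ
  have hS : γ * (φ ⬝ᵥ φ) ≤ φ ⬝ᵥ (Δ *ᵥ φ) := hc φ
  have hκφ : 0 ≤ κ * (φ ⬝ᵥ φ) / 2 := div_nonneg (mul_nonneg hκ hφ) two_pos.le
  rw [abs_mul, abs_mul, abs_neg, abs_div, abs_two, Real.abs_exp]
  calc |φ ⬝ᵥ (D *ᵥ φ)| / 2 * Real.exp (-(φ ⬝ᵥ (Δ *ᵥ φ) / 2)) * |g φ|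
      ≤ κ * (φ ⬝ᵥ φ) / 2 * Real.exp (-(γ * (φ ⬝ᵥ φ) / 2)) * G := by
        refine mul_le_mul (mul_le_mul (div_le_div_of_nonneg_right (hD φ) two_pos.le)
          (Real.exp_le_exp.2 (by linarith)) (Real.exp_pos _).le hκφ) (hgb φ) (abs_nonneg _)
          (mul_nonneg hκφ (Real.exp_pos _).le)
    _ = κ * G / 2 * ((φ ⬝ᵥ φ) * Real.exp (-(γ * (φ ⬝ᵥ φ) / 2))) := by ring
    _ ≤ κ * G / 2 * (4 / γ * Real.exp (-(γ * (φ ⬝ᵥ φ) / 4))) :=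
        mul_le_mul_of_nonneg_left (mul_exp_neg_le hγ _) (div_nonneg (mul_nonneg hκ hG) two_pos.le)
    _ = 2 * κ * G / γ * Real.exp (-(γ / 2 * (φ ⬝ᵥ φ) / 2)) := by
        rw [show -(γ / 2 * (φ ⬝ᵥ φ) / 2) = -(γ * (φ ⬝ᵥ φ) / 4) by ring]
        ring

/-- The path-derivative integrand is Lebesgue-integrable. [folklore] -/
theorem integrable_pathDeriv_integrand {Δ D : Matrix ι ι ℝ} {γ κ G : ℝ} (hγ : 0 < γ) (hκ : 0 ≤ κ) (hc : Coercive Δ γ)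
    (hD : ∀ φ : ι → ℝ, |φ ⬝ᵥ (D *ᵥ φ)| ≤ κ * (φ ⬝ᵥ φ)) {g : (ι → ℝ) → ℝ} (hgm : Measurable g) (hgb : ∀ φ, |g φ| ≤ G) :
    Integrable (fun φ : ι → ℝ => -(φ ⬝ᵥ (D *ᵥ φ) / 2) * Real.exp (-(φ ⬝ᵥ (Δ *ᵥ φ) / 2)) * g φ) := by
  refine ((integrable_exp_neg_mul_dotProduct (ι := ι) (half_pos hγ)).const_mul (2 * κ * G / γ)).mono'
    (((((measurable_quadForm D).div_const 2).neg).mul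
      (Real.measurable_exp.comp ((measurable_quadForm Δ).div_const 2).neg)).mul hgm).aestronglyMeasurable
    (Eventually.of_forall fun φ => ?_)
  rw [Real.norm_eq_abs]
  exact abs_pathDeriv_integrand_le hγ hκ hc hD hgb φ

/-- **★ FEYNMAN–HELLMANN ALONG AN AFFINE PATH OF COERCIVE QUADRATIC ACTIONS on `ι → ℝ`** [folklore; Mathlib `hasDerivAt_integral_of_dominated_loc_of_deriv_le`]:
`Δ + uD` `γ`-coercive for `u` in a neighbourhood `s` of `u₀`, `|φ·Dφ| ≤ κφ·φ`, `g` bounded measurable ⇒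
`d∕du ∫ e^{−½φ·(Δ+uD)φ} g(φ) dφ |_{u₀} = ∫ (−½φ·Dφ) e^{−½φ·(Δ+u₀D)φ} g(φ) dφ`.  (The `ι = Tor M` instance is p515255's `hasDerivAt_integral_exp_neg_pathAction`.) -/
theorem hasDerivAt_integral_exp_neg_path {Δ D : Matrix ι ι ℝ} {γ κ G u₀ : ℝ} {s : Set ℝ}
    (hγ : 0 < γ) (hκ : 0 ≤ κ) (hs : s ∈ 𝓝 u₀) (hco : ∀ u ∈ s, Coercive (Δ + u • D) γ)
    (hD : ∀ φ : ι → ℝ, |φ ⬝ᵥ (D *ᵥ φ)| ≤ κ * (φ ⬝ᵥ φ)) {g : (ι → ℝ) → ℝ} (hgm : Measurable g) (hgb : ∀ φ, |g φ| ≤ G) :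
    HasDerivAt (fun u => ∫ φ : ι → ℝ, Real.exp (-(φ ⬝ᵥ ((Δ + u • D) *ᵥ φ) / 2)) * g φ)
      (∫ φ : ι → ℝ, -(φ ⬝ᵥ (D *ᵥ φ) / 2) * Real.exp (-(φ ⬝ᵥ ((Δ + u₀ • D) *ᵥ φ) / 2)) * g φ) u₀ := by
  have hu₀ : u₀ ∈ s := mem_of_mem_nhds hs
  have hmeas : ∀ u : ℝ, Measurable fun φ : ι → ℝ => Real.exp (-(φ ⬝ᵥ ((Δ + u • D) *ᵥ φ) / 2)) * g φ :=
    fun u => (Real.measurable_exp.comp ((measurable_quadForm _).div_const 2).neg).mul hgm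
  have hmeas' : ∀ u : ℝ, Measurable fun φ : ι → ℝ =>
      -(φ ⬝ᵥ (D *ᵥ φ) / 2) * Real.exp (-(φ ⬝ᵥ ((Δ + u • D) *ᵥ φ) / 2)) * g φ :=
    fun u => ((((measurable_quadForm D).div_const 2).neg).mul
      (Real.measurable_exp.comp ((measurable_quadForm _).div_const 2).neg)).mul hgm
  refine (hasDerivAt_integral_of_dominated_loc_of_deriv_le
    (F := fun u φ => Real.exp (-(φ ⬝ᵥ ((Δ + u • D) *ᵥ φ) / 2)) * g φ)
    (F' := fun u φ => -(φ ⬝ᵥ (D *ᵥ φ) / 2) * Real.exp (-(φ ⬝ᵥ ((Δ + u • D) *ᵥ φ) / 2)) * g φ)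
    (bound := fun φ => 2 * κ * G / γ * Real.exp (-(γ / 2 * (φ ⬝ᵥ φ) / 2))) hs
    (Eventually.of_forall fun u => (hmeas u).aestronglyMeasurable) ?_ (hmeas' u₀).aestronglyMeasurable ?_ ?_ ?_).2
  · exact (integrable_exp_neg_quadForm hγ (hco u₀ hu₀)).mul_bdd hgm.aestronglyMeasurable
      (Eventually.of_forall fun φ => by rw [Real.norm_eq_abs]; exact hgb φ)
  · exact Eventually.of_forall fun φ u hu => by
      rw [Real.norm_eq_abs]
      exact abs_pathDeriv_integrand_le hγ hκ (hco u hu) hD hgb φ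
  · exact (integrable_exp_neg_mul_dotProduct (ι := ι) (half_pos hγ)).const_mul _
  · refine Eventually.of_forall fun φ u _ => ?_
    have hlin : HasDerivAt (fun v : ℝ => -(φ ⬝ᵥ (D *ᵥ φ) / 2) * v + -(φ ⬝ᵥ (Δ *ᵥ φ) / 2))
        (-(φ ⬝ᵥ (D *ᵥ φ) / 2) * 1) u := ((hasDerivAt_id' u).const_mul _).add_const _
    have hexp : HasDerivAt (fun v : ℝ => -(φ ⬝ᵥ ((Δ + v • D) *ᵥ φ) / 2)) (-(φ ⬝ᵥ (D *ᵥ φ) / 2)) u := by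
      refine (hlin.congr_of_eventuallyEq (Eventually.of_forall fun v => ?_)).congr_deriv (mul_one _)
      simp only [dotProduct_add_smul_mulVec]
      ring
    exact (hexp.exp.mul_const (g φ)).congr_deriv (by ring)

/-- **CONTINUITY OF THE PATH PARTITION FUNCTION** where the actions are uniformly coercive [folklore; Mathlib `continuousOn_of_dominated`]. -/
theorem continuousOn_integral_exp_neg_path {Δ D : Matrix ι ι ℝ} {γ G : ℝ} {s : Set ℝ} (hγ : 0 < γ)
    (hco : ∀ u ∈ s, Coercive (Δ + u • D) γ) {g : (ι → ℝ) → ℝ} (hgm : Measurable g) (hgb : ∀ φ, |g φ| ≤ G) :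
    ContinuousOn (fun u => ∫ φ : ι → ℝ, Real.exp (-(φ ⬝ᵥ ((Δ + u • D) *ᵥ φ) / 2)) * g φ) s := by
  have hmeas : ∀ u : ℝ, Measurable fun φ : ι → ℝ => Real.exp (-(φ ⬝ᵥ ((Δ + u • D) *ᵥ φ) / 2)) * g φ :=
    fun u => (Real.measurable_exp.comp ((measurable_quadForm _).div_const 2).neg).mul hgm
  refine continuousOn_of_dominated (bound := fun φ => G * Real.exp (-(γ * (φ ⬝ᵥ φ) / 2)))
    (fun u _ => (hmeas u).aestronglyMeasurable) (fun u hu => Eventually.of_forall fun φ => ?_)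
    ((integrable_exp_neg_mul_dotProduct (ι := ι) hγ).const_mul G) (Eventually.of_forall fun φ => ?_)
  · have hS : γ * (φ ⬝ᵥ φ) ≤ φ ⬝ᵥ ((Δ + u • D) *ᵥ φ) := hco u hu φ
    rw [Real.norm_eq_abs, abs_mul, Real.abs_exp, mul_comm]
    exact mul_le_mul (hgb φ) (Real.exp_le_exp.2 (by linarith)) (Real.exp_pos _).le ((abs_nonneg _).trans (hgb φ))
  · have hc : Continuous fun u : ℝ => Real.exp (-((φ ⬝ᵥ (Δ *ᵥ φ) + u * (φ ⬝ᵥ (D *ᵥ φ))) / 2)) * g φ := by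
      fun_prop
    simp only [dotProduct_add_smul_mulVec]
    exact hc.continuousOn

end FeynmanHellmann

/-! ## §3 Equipartition on `ι → ℝ`: the Gaussian mean of the action is the dimension `|ι|` -/
section Equipartition

/-- **★ EQUIPARTITION** [folklore]: for a `γ`-coercive (`γ > 0`) real matrix `Δ` on the finite index `ι`, `∫ (φ·Δφ)·e^{−½φ·Δφ} dφ = |ι| · ∫ e^{−½φ·Δφ} dφ`.  Proof as in
p515255 (`ι = Tor M`): the scaling identity `∫ e^{−c²φ·Δφ∕2}dφ = c^{−|ι|}·∫ e^{−φ·Δφ∕2}dφ` (Mathlib `Measure.integral_comp_smul`) differentiated at `c = 1` against §2 and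
`HasDerivAt.unique`. -/
theorem integral_quadForm_mul_exp_neg {Δ : Matrix ι ι ℝ} {γ : ℝ} (hγ : 0 < γ) (hc : Coercive Δ γ) :
    ∫ φ : ι → ℝ, φ ⬝ᵥ (Δ *ᵥ φ) * Real.exp (-(φ ⬝ᵥ (Δ *ᵥ φ) / 2))
      = Fintype.card ι * ∫ φ : ι → ℝ, Real.exp (-(φ ⬝ᵥ (Δ *ᵥ φ) / 2)) := by
  set F1 : ℝ := ∫ φ : ι → ℝ, Real.exp (-(φ ⬝ᵥ (Δ *ᵥ φ) / 2)) with hF1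
  set K : ℝ := ∫ φ : ι → ℝ, φ ⬝ᵥ (Δ *ᵥ φ) * Real.exp (-(φ ⬝ᵥ (Δ *ᵥ φ) / 2)) with hK
  -- (1) Feynman–Hellmann at `u₀ = 1` for the ray `u ↦ 0 + u•Δ`, coercive with `γ/2` on `u > 1/2`
  have hray : ∀ u ∈ Set.Ioi (1 / 2 : ℝ), Coercive ((0 : Matrix ι ι ℝ) + u • Δ) (γ / 2) := fun u hu φ => by
    rw [dotProduct_add_smul_mulVec, Matrix.zero_mulVec, dotProduct_zero, zero_add]
    have h1 := hc φ
    have h0 := dotProduct_self_nonneg_real φ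
    have hS0 : 0 ≤ φ ⬝ᵥ (Δ *ᵥ φ) := (mul_nonneg hγ.le h0).trans h1
    have hu' : (1 / 2 : ℝ) < u := hu
    nlinarith [mul_nonneg (sub_nonneg.2 hu'.le) hS0]
  have hκ : 0 ≤ ∑ x, ∑ y, |Δ x y| := Finset.sum_nonneg fun x _ => Finset.sum_nonneg fun y _ => abs_nonneg _
  have hFH : HasDerivAt (fun u : ℝ => ∫ φ : ι → ℝ, Real.exp (-(u * (φ ⬝ᵥ (Δ *ᵥ φ)) / 2)))
      (∫ φ : ι → ℝ, -(φ ⬝ᵥ (Δ *ᵥ φ) / 2) * Real.exp (-(φ ⬝ᵥ (Δ *ᵥ φ) / 2))) 1 := by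
    have h := hasDerivAt_integral_exp_neg_path (ι := ι) (half_pos hγ) hκ (Ioi_mem_nhds (by norm_num : (1 / 2 : ℝ) < 1)) hray
      (abs_quadForm_le Δ) (g := fun _ => (1 : ℝ)) measurable_const (fun _ => le_of_eq abs_one)
    simpa only [zero_add, dotProduct_smul_mulVec, one_smul, one_mul, mul_one] using h
  have hΦ' : ∫ φ : ι → ℝ, -(φ ⬝ᵥ (Δ *ᵥ φ) / 2) * Real.exp (-(φ ⬝ᵥ (Δ *ᵥ φ) / 2)) = -(1 / 2) * K := by
    rw [hK, ← integral_const_mul]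
    refine integral_congr_ae (Eventually.of_forall fun φ => ?_)
    simp only
    ring
  rw [hΦ'] at hFH
  -- (2) compose with `c ↦ c²`
  have hsq : HasDerivAt (fun x : ℝ => x ^ 2) 2 1 := by
    simpa using hasDerivAt_pow 2 (1 : ℝ)
  have hcomp := hFH.comp_of_eq (1 : ℝ) hsq (by norm_num)
  -- (3) the scaling identity on `c > 0`
  have hscale : ∀ c : ℝ, 0 < c →
      ((fun u : ℝ => ∫ φ : ι → ℝ, Real.exp (-(u * (φ ⬝ᵥ (Δ *ᵥ φ)) / 2))) ∘ fun x : ℝ => x ^ 2) c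
        = (c ^ Fintype.card ι)⁻¹ * F1 := by
    intro c hc0
    have hfun : (fun φ : ι → ℝ => Real.exp (-(c ^ 2 * (φ ⬝ᵥ (Δ *ᵥ φ)) / 2)))
        = fun φ => (fun ψ : ι → ℝ => Real.exp (-(ψ ⬝ᵥ (Δ *ᵥ ψ) / 2))) (c • φ) := by
      funext φ
      simp only
      rw [dotProduct_mulVec_smul Δ c φ]
    simp only [Function.comp_apply]
    rw [hfun, Measure.integral_comp_smul volume (fun ψ : ι → ℝ => Real.exp (-(ψ ⬝ᵥ (Δ *ᵥ ψ) / 2))) c]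
    rw [Module.finrank_fintype_fun_eq_card, smul_eq_mul, abs_of_pos (inv_pos.2 (pow_pos hc0 _))]
  -- (4) the explicit derivative of the scaled side at `c = 1`
  have hpow : HasDerivAt (fun c : ℝ => (c ^ Fintype.card ι)⁻¹ * F1) (-(Fintype.card ι : ℝ) * F1) 1 := by
    have h := ((hasDerivAt_pow (Fintype.card ι) (1 : ℝ)).fun_inv (by simp)).mul_const F1
    simp (config := { failIfUnchanged := false }) only [one_pow, mul_one, div_one] at h
    exact h
  -- (5) the two functions agree near `c = 1`; uniqueness of the derivative
  have hEq : (fun c : ℝ => (c ^ Fintype.card ι)⁻¹ * F1)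
      =ᶠ[𝓝 (1 : ℝ)] ((fun u : ℝ => ∫ φ : ι → ℝ, Real.exp (-(u * (φ ⬝ᵥ (Δ *ᵥ φ)) / 2))) ∘ fun x : ℝ => x ^ 2) :=
    (eventually_gt_nhds one_pos).mono fun c hc0 => (hscale c hc0).symm
  have huniq := hpow.unique (hcomp.congr_of_eventuallyEq hEq)
  linarith

end Equipartition

end Summit.QuantumFields.YangMills.BalabanUVNodes.N19AnnealedGeneric

end
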